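import Mathlib
import Literature.Analysis.SpecialFunctions.BesselHeatKernelGreen
import HarnessLib

/-!
# The Chapman–Kolmogorov pairing of two radial heat kernels: differentiation under the integral sign

For `μ, ν ≥ 0` with `μ + ν > 0` and `t, x, y > 0`, the pairing
`D(s) = ∫_0^∞ q^{(ν)}_{t-s}(x,z) q^{(μ)}_s(y,z) z dz` (`0 < s < t`) of the kernels of `BesselHeatKernel.lean` is
differentiable on `(0,t)` with
  `D′(s) = ∫_0^∞ (-(∂_τ q^{(ν)}_{t-s})(x,z) q^{(μ)}_s(y,z) + q^{(ν)}_{t-s}(x,z) (∂_s q^{(μ)}_s)(y,z)) z dz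
        = (ν² - μ²)/2 · ∫_0^∞ q^{(ν)}_{t-s}(x,z) q^{(μ)}_s(y,z) z⁻¹ dz`
(`hasDerivAt_duhamelPairing`; the second equality is Green's identity `integral_green_besselHeatKernel`).  The
differentiation under the integral sign (`hasDerivAt_integral_of_dominated_loc_of_deriv_le`) uses bounds on the kernels
and their time derivatives that are UNIFORM for times in a compact sub-rectangle:
`besselHeatKernel_mul_le_of_le` (Gaussian product bound) and `abs_besselHeatDt_le_of_le`.  This is the Duhamel step
of the comparison of radial heat kernels of different index behind the Hartman–Watson law [RevuzYor1999, Ch. XI §1].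

## References
* D. Revuz, M. Yor, *Continuous Martingales and Brownian Motion*, 3rd ed. (1999), Ch. XI §1. [RevuzYor1999]
-/

noncomputable section

open Filter Topology Real MeasureTheory Set Metric
open scoped Nat BigOperators

namespace Literature.Analysis.SpecialFunctions

section UniformBounds

variable {μ ν x y : ℝ}

/-- **Uniform Gaussian product bound**: for `τ₀ ≤ τ ≤ T` and `s₀ ≤ s` (`τ₀, s₀ > 0`),
`q^{(ν)}_τ(x,z) q^{(μ)}_s(y,z) ≤ C(τ₀,s₀) · z^{μ+ν} e^{-z²/(4T)}`. [cite: RevuzYor1999, Ch. XI §1] -/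
theorem besselHeatKernel_mul_le_of_le (hμ : 0 ≤ μ) (hν : 0 ≤ ν) {τ₀ s₀ T τ s : ℝ} (hτ₀ : 0 < τ₀) (hs₀ : 0 < s₀)
    (hτ : τ₀ ≤ τ) (hτT : τ ≤ T) (hs : s₀ ≤ s) (hx : 0 < x) (hy : 0 < y) {z : ℝ} (hz : 0 < z) :
    besselHeatKernel ν τ x z * besselHeatKernel μ s y z ≤
      ((τ₀⁻¹ * (x / (2 * τ₀)) ^ ν * Real.exp (x ^ 2 / (2 * τ₀)) / Real.Gamma (ν + 1)) *
        (s₀⁻¹ * (y / (2 * s₀)) ^ μ / Real.Gamma (μ + 1))) * (z ^ (μ + ν) * Real.exp (-(1 / (4 * T)) * z ^ 2)) := by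
  have hτ' : 0 < τ := lt_of_lt_of_le hτ₀ hτ
  have hs' : 0 < s := lt_of_lt_of_le hs₀ hs
  have hT : 0 < T := lt_of_lt_of_le hτ' hτT
  have hGν : 0 < Real.Gamma (ν + 1) := Real.Gamma_pos_of_pos (by linarith)
  have hGμ : 0 < Real.Gamma (μ + 1) := Real.Gamma_pos_of_pos (by linarith)
  have h := besselHeatKernel_mul_le hμ hν hτ' hs' hx hy hz
  refine h.trans ?_
  have h1 : τ⁻¹ ≤ τ₀⁻¹ := inv_anti₀ hτ₀ hτ
  have h2 : (x / (2 * τ)) ^ ν ≤ (x / (2 * τ₀)) ^ ν :=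
    Real.rpow_le_rpow (by positivity) (div_le_div_of_nonneg_left hx.le (by positivity) (by linarith)) hν
  have h3 : Real.exp (x ^ 2 / (2 * τ)) ≤ Real.exp (x ^ 2 / (2 * τ₀)) :=
    Real.exp_le_exp.2 (div_le_div_of_nonneg_left (sq_nonneg x) (by positivity) (by linarith))
  have h4 : s⁻¹ ≤ s₀⁻¹ := inv_anti₀ hs₀ hs
  have h5 : (y / (2 * s)) ^ μ ≤ (y / (2 * s₀)) ^ μ :=
    Real.rpow_le_rpow (by positivity) (div_le_div_of_nonneg_left hy.le (by positivity) (by linarith)) hμ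
  have h6 : Real.exp (-(1 / (4 * τ)) * z ^ 2) ≤ Real.exp (-(1 / (4 * T)) * z ^ 2) := by
    refine Real.exp_le_exp.2 (mul_le_mul_of_nonneg_right (neg_le_neg ?_) (sq_nonneg z))
    exact one_div_le_one_div_of_le (by positivity) (by linarith)
  gcongr

/-- **Uniform bound of the time derivative**: for `τ₀ ≤ τ` (`τ₀ > 0`),
`|∂_τ q^{(κ)}_τ(x,z)| ≤ q^{(κ)}_τ(x,z) · (A(τ₀) + B(τ₀) z²)` with `A = (1+κ)/τ₀ + x²/(2τ₀²)`,
`B = 1/(2τ₀²) + x²/(2τ₀³)`. [cite: RevuzYor1999, Ch. XI §1] -/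
theorem abs_besselHeatDt_le_of_le {κ : ℝ} (hκ : 0 ≤ κ) {τ₀ τ : ℝ} (hτ₀ : 0 < τ₀) (hτ : τ₀ ≤ τ) (hx : 0 < x)
    {z : ℝ} (hz : 0 < z) :
    |besselHeatDt κ τ x z| ≤ besselHeatKernel κ τ x z *
      (((1 + κ) / τ₀ + x ^ 2 / (2 * τ₀ ^ 2)) + (1 / (2 * τ₀ ^ 2) + x ^ 2 / (2 * τ₀ ^ 3)) * z ^ 2) := by
  have hτ' : 0 < τ := lt_of_lt_of_le hτ₀ hτ
  have h := abs_besselHeatDt_le hκ hτ' hx hz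
  have hR : (1 + κ) / τ + (x ^ 2 + z ^ 2) / (2 * τ ^ 2) + 2 * besselHeatArg τ x z / τ =
      ((1 + κ) / τ + x ^ 2 / (2 * τ ^ 2)) + (1 / (2 * τ ^ 2) + x ^ 2 / (2 * τ ^ 3)) * z ^ 2 := by
    unfold besselHeatArg; field_simp; ring
  rw [hR] at h
  refine h.trans (mul_le_mul_of_nonneg_left ?_ (besselHeatKernel_pos hκ hτ' hx hz).le)
  have hτ2 : τ₀ ^ 2 ≤ τ ^ 2 := pow_le_pow_left₀ hτ₀.le hτ 2
  have hτ3 : τ₀ ^ 3 ≤ τ ^ 3 := pow_le_pow_left₀ hτ₀.le hτ 3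
  have hκ1 : 0 ≤ 1 + κ := by linarith
  gcongr

/-- `q^{(ν)}_τ(x,z) q^{(μ)}_s(y,z) z` is integrable on `(0,∞)`. [cite: RevuzYor1999, Ch. XI §1] -/
theorem integrableOn_besselHeatKernel_mul_mul (hμ : 0 ≤ μ) (hν : 0 ≤ ν) {τ s : ℝ} (hτ : 0 < τ) (hs : 0 < s)
    (hx : 0 < x) (hy : 0 < y) :
    IntegrableOn (fun z => besselHeatKernel ν τ x z * besselHeatKernel μ s y z * z) (Ioi 0) := by
  set C : ℝ := (τ⁻¹ * (x / (2 * τ)) ^ ν * Real.exp (x ^ 2 / (2 * τ)) / Real.Gamma (ν + 1)) *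
    (s⁻¹ * (y / (2 * s)) ^ μ / Real.Gamma (μ + 1)) with hC
  have hdom : IntegrableOn (fun z : ℝ => C * (z ^ (μ + ν + 1) * Real.exp (-(1 / (4 * τ)) * z ^ 2))) (Ioi 0) :=
    (integrableOn_rpow_mul_exp_neg_mul_sq (b := 1 / (4 * τ)) (by positivity) (s := μ + ν + 1)
      (by linarith)).const_mul C
  refine Integrable.mono' hdom ?_ ?_
  · exact (((continuous_besselHeatKernel_right hν τ x).mul (continuous_besselHeatKernel_right hμ s y)).mul
      continuous_id).aestronglyMeasurable
  · refine ae_restrict_of_forall_mem measurableSet_Ioi fun z hz => ?_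
    have hz' : (0 : ℝ) < z := hz
    have hnn : 0 ≤ besselHeatKernel ν τ x z * besselHeatKernel μ s y z :=
      mul_nonneg (besselHeatKernel_pos hν hτ hx hz').le (besselHeatKernel_pos hμ hs hy hz').le
    rw [Real.norm_eq_abs, abs_of_nonneg (mul_nonneg hnn hz'.le)]
    have h := besselHeatKernel_mul_le hμ hν hτ hs hx hy hz'
    have hzpow : z ^ (μ + ν) * z = z ^ (μ + ν + 1) := by rw [Real.rpow_add_one hz'.ne']
    calc besselHeatKernel ν τ x z * besselHeatKernel μ s y z * z
        ≤ C * (z ^ (μ + ν) * Real.exp (-(1 / (4 * τ)) * z ^ 2)) * z := mul_le_mul_of_nonneg_right h hz'.le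
      _ = C * (z ^ (μ + ν + 1) * Real.exp (-(1 / (4 * τ)) * z ^ 2)) := by rw [← hzpow]; ring

end UniformBounds

/-! ## Differentiation of the pairing under the integral sign -/

section Deriv

variable {μ ν t x y : ℝ}

/-- **The derivative of the Chapman–Kolmogorov pairing** `D(s) = ∫_0^∞ q^{(ν)}_{t-s}(x,z) q^{(μ)}_s(y,z) z dz` on `(0,t)`:
`D′(s) = (ν²-μ²)/2 ∫_0^∞ q^{(ν)}_{t-s}(x,z) q^{(μ)}_s(y,z) z⁻¹ dz` (differentiation under the integral sign + Green's
identity `integral_green_besselHeatKernel`). [cite: RevuzYor1999, Ch. XI §1] -/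
theorem hasDerivAt_duhamelPairing (hμ : 0 ≤ μ) (hν : 0 ≤ ν) (hμν : 0 < μ + ν) (ht : 0 < t) (hx : 0 < x) (hy : 0 < y)
    {s : ℝ} (hs : 0 < s) (hst : s < t) :
    HasDerivAt (fun s : ℝ => ∫ z in Ioi (0 : ℝ), besselHeatKernel ν (t - s) x z * besselHeatKernel μ s y z * z)
      ((ν ^ 2 - μ ^ 2) / 2 * ∫ z in Ioi (0 : ℝ), besselHeatKernel ν (t - s) x z * besselHeatKernel μ s y z / z) s := by
  -- the localisation radius and the uniform lower bounds of the two times on the ball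
  set ε : ℝ := min s (t - s) / 2 with hε
  have hmin : 0 < min s (t - s) := lt_min hs (by linarith)
  have hε0 : 0 < ε := by rw [hε]; linarith
  have hεs : ε ≤ s / 2 := by rw [hε]; linarith [min_le_left s (t - s)]
  have hεt : ε ≤ (t - s) / 2 := by rw [hε]; linarith [min_le_right s (t - s)]
  set s₀ : ℝ := s - ε with hs₀
  set τ₀ : ℝ := t - s - ε with hτ₀
  have hs₀0 : 0 < s₀ := by rw [hs₀]; linarith
  have hτ₀0 : 0 < τ₀ := by rw [hτ₀]; linarith
  have hball : ∀ s' ∈ ball s ε, s₀ ≤ s' ∧ τ₀ ≤ t - s' ∧ t - s' ≤ t ∧ 0 < s' ∧ 0 < t - s' := by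
    intro s' hs'
    rw [mem_ball, Real.dist_eq, abs_lt] at hs'
    refine ⟨by rw [hs₀]; linarith, by rw [hτ₀]; linarith, by linarith, by linarith, by linarith⟩
  -- the integrand, its `s`-derivative and the dominating function
  set F : ℝ → ℝ → ℝ := fun s' z => besselHeatKernel ν (t - s') x z * besselHeatKernel μ s' y z * z with hF
  set F' : ℝ → ℝ → ℝ := fun s' z =>
    (-(besselHeatDt ν (t - s') x z) * besselHeatKernel μ s' y z
      + besselHeatKernel ν (t - s') x z * besselHeatDt μ s' y z) * z with hF'
  set C : ℝ := (τ₀⁻¹ * (x / (2 * τ₀)) ^ ν * Real.exp (x ^ 2 / (2 * τ₀)) / Real.Gamma (ν + 1)) *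
    (s₀⁻¹ * (y / (2 * s₀)) ^ μ / Real.Gamma (μ + 1)) with hC
  set A : ℝ := ((1 + ν) / τ₀ + x ^ 2 / (2 * τ₀ ^ 2)) + ((1 + μ) / s₀ + y ^ 2 / (2 * s₀ ^ 2)) with hA
  set B : ℝ := (1 / (2 * τ₀ ^ 2) + x ^ 2 / (2 * τ₀ ^ 3)) + (1 / (2 * s₀ ^ 2) + y ^ 2 / (2 * s₀ ^ 3)) with hB
  set bound : ℝ → ℝ := fun z => C * (A * (z ^ (μ + ν + 1) * Real.exp (-(1 / (4 * t)) * z ^ 2))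
    + B * (z ^ (μ + ν + 3) * Real.exp (-(1 / (4 * t)) * z ^ 2))) with hbound
  have hGν : 0 < Real.Gamma (ν + 1) := Real.Gamma_pos_of_pos (by linarith)
  have hGμ : 0 < Real.Gamma (μ + 1) := Real.Gamma_pos_of_pos (by linarith)
  have hC0 : 0 ≤ C := by rw [hC]; positivity
  -- (1) measurability of `F s'` for every `s'`
  have hF_meas : ∀ᶠ s' in 𝓝 s, AEStronglyMeasurable (F s') (volume.restrict (Ioi 0)) :=
    Eventually.of_forall fun s' =>
      (((continuous_besselHeatKernel_right hν (t - s') x).mul (continuous_besselHeatKernel_right hμ s' y)).mul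
        continuous_id).aestronglyMeasurable
  -- (2) integrability of `F s`
  have hF_int : Integrable (F s) (volume.restrict (Ioi 0)) :=
    integrableOn_besselHeatKernel_mul_mul hμ hν (by linarith) hs hx hy
  -- (3) measurability of `F' s`
  have hF'_meas : AEStronglyMeasurable (F' s) (volume.restrict (Ioi 0)) := by
    refine ContinuousOn.aestronglyMeasurable ?_ measurableSet_Ioi
    refine ContinuousOn.mul (ContinuousOn.add ?_ ?_) continuousOn_id
    · exact ((continuousOn_besselHeatDt_right hν (t - s) x).neg).mul
        (continuous_besselHeatKernel_right hμ s y).continuousOn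
    · exact (continuous_besselHeatKernel_right hν (t - s) x).continuousOn.mul
        (continuousOn_besselHeatDt_right hμ s y)
  -- (4) domination of `F'` on the ball
  have h_bound : ∀ᵐ z ∂(volume.restrict (Ioi 0)), ∀ s' ∈ ball s ε, ‖F' s' z‖ ≤ bound z := by
    refine ae_restrict_of_forall_mem measurableSet_Ioi fun z hz s' hs' => ?_
    have hz' : (0 : ℝ) < z := hz
    obtain ⟨h1, h2, h3, h4, h5⟩ := hball s' hs'
    have hf0 : 0 ≤ besselHeatKernel ν (t - s') x z := (besselHeatKernel_pos hν h5 hx hz').le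
    have hg0 : 0 ≤ besselHeatKernel μ s' y z := (besselHeatKernel_pos hμ h4 hy hz').le
    have hdf := abs_besselHeatDt_le_of_le hν hτ₀0 h2 hx hz'
    have hdg := abs_besselHeatDt_le_of_le hμ hs₀0 h1 hy hz'
    have hprod := besselHeatKernel_mul_le_of_le hμ hν hτ₀0 hs₀0 h2 h3 h1 hx hy hz'
    rw [← hC] at hprod
    have hAB : (((1 + ν) / τ₀ + x ^ 2 / (2 * τ₀ ^ 2)) + (1 / (2 * τ₀ ^ 2) + x ^ 2 / (2 * τ₀ ^ 3)) * z ^ 2)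
        + (((1 + μ) / s₀ + y ^ 2 / (2 * s₀ ^ 2)) + (1 / (2 * s₀ ^ 2) + y ^ 2 / (2 * s₀ ^ 3)) * z ^ 2)
        = A + B * z ^ 2 := by rw [hA, hB]; ring
    have hA0 : 0 ≤ A := by rw [hA]; positivity
    have hB0 : 0 ≤ B := by rw [hB]; positivity
    rw [Real.norm_eq_abs]
    have hz1 : z ^ (μ + ν) * z = z ^ (μ + ν + 1) := by rw [Real.rpow_add_one hz'.ne']
    have hz3 : z ^ (μ + ν) * z * z ^ 2 = z ^ (μ + ν + 3) := by
      rw [show μ + ν + 3 = (μ + ν) + ((3 : ℕ) : ℝ) by push_cast; ring, Real.rpow_add hz' (μ + ν) ((3 : ℕ) : ℝ),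
        Real.rpow_natCast]; ring
    calc |F' s' z| = |(-(besselHeatDt ν (t - s') x z) * besselHeatKernel μ s' y z
            + besselHeatKernel ν (t - s') x z * besselHeatDt μ s' y z)| * z := by
          rw [hF']; simp only [abs_mul, abs_of_pos hz']
      _ ≤ (|besselHeatDt ν (t - s') x z| * besselHeatKernel μ s' y z
            + besselHeatKernel ν (t - s') x z * |besselHeatDt μ s' y z|) * z := by
          refine mul_le_mul_of_nonneg_right ((abs_add_le _ _).trans (le_of_eq ?_)) hz'.le
          rw [abs_mul, abs_mul, abs_neg, abs_of_nonneg hg0, abs_of_nonneg hf0]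
      _ ≤ ((besselHeatKernel ν (t - s') x z *
              (((1 + ν) / τ₀ + x ^ 2 / (2 * τ₀ ^ 2)) + (1 / (2 * τ₀ ^ 2) + x ^ 2 / (2 * τ₀ ^ 3)) * z ^ 2))
              * besselHeatKernel μ s' y z
            + besselHeatKernel ν (t - s') x z * (besselHeatKernel μ s' y z *
              (((1 + μ) / s₀ + y ^ 2 / (2 * s₀ ^ 2)) + (1 / (2 * s₀ ^ 2) + y ^ 2 / (2 * s₀ ^ 3)) * z ^ 2))) * z := by
          gcongr
      _ = (besselHeatKernel ν (t - s') x z * besselHeatKernel μ s' y z) * ((A + B * z ^ 2) * z) := by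
          rw [← hAB]; ring
      _ ≤ (C * (z ^ (μ + ν) * Real.exp (-(1 / (4 * t)) * z ^ 2))) * ((A + B * z ^ 2) * z) :=
          mul_le_mul_of_nonneg_right hprod (by positivity)
      _ = bound z := by rw [hbound]; simp only; rw [← hz1, ← hz3]; ring
  -- (5) integrability of the bound
  have bound_integrable : Integrable bound (volume.restrict (Ioi 0)) := by
    refine Integrable.const_mul (Integrable.add ?_ ?_) C
    · exact (integrableOn_rpow_mul_exp_neg_mul_sq (b := 1 / (4 * t)) (by positivity) (s := μ + ν + 1)
        (by linarith)).const_mul A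
    · exact (integrableOn_rpow_mul_exp_neg_mul_sq (b := 1 / (4 * t)) (by positivity) (s := μ + ν + 3)
        (by linarith)).const_mul B
  -- (6) pointwise differentiability on the ball
  have h_diff : ∀ᵐ z ∂(volume.restrict (Ioi 0)), ∀ s' ∈ ball s ε, HasDerivAt (fun s' => F s' z) (F' s' z) s' := by
    refine ae_restrict_of_forall_mem measurableSet_Ioi fun z hz s' hs' => ?_
    have hz' : (0 : ℝ) < z := hz
    obtain ⟨-, -, -, h4, h5⟩ := hball s' hs'
    have hf : HasDerivAt (fun s' : ℝ => besselHeatKernel ν (t - s') x z) (besselHeatDt ν (t - s') x z * (-1)) s' :=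
      (hasDerivAt_besselHeatKernel_t hν h5 hx hz').comp s' ((hasDerivAt_id s').const_sub t)
    have hg : HasDerivAt (fun s' : ℝ => besselHeatKernel μ s' y z) (besselHeatDt μ s' y z) s' :=
      hasDerivAt_besselHeatKernel_t hμ h4 hy hz'
    have h := (hf.mul hg).mul_const z
    refine h.congr_deriv ?_
    rw [hF']
    ring
  -- differentiate under the integral sign and use Green's identity
  have key := hasDerivAt_integral_of_dominated_loc_of_deriv_le (ball_mem_nhds s hε0) hF_meas hF_int hF'_meas h_bound
    bound_integrable h_diff
  have hG := integral_green_besselHeatKernel hμ hν hμν (τ := t - s) (s := s) (by linarith) hs hx hy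
  refine key.2.congr_deriv ?_
  rw [hF']
  exact hG

end Deriv

end Literature.Analysis.SpecialFunctions

end
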